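import Literature.Analysis.FluidPDE.CheskidovTotalDissipation
import Literature.Analysis.FunctionSpaces.HolderNorm
import Literature.Analysis.FunctionSpaces.TorusSobolevNorm
import HarnessLib

/-!
# Cheskidov's no-dissipation-anomaly family (arXiv:2311.04182, §3 and §4, viscosities `ν_m = m⁻¹λ_m⁻²`)

Topic `Literature/Analysis/FluidPDE` (family `turb`). The barrier fact
`Literature.Barriers.AnomalousDissipation.Cheskidov2023_thm21_noDissipationAnomaly`
(`Literature/Barriers/AnomalousDissipation/AnomalousDissipationWithoutDissipationAnomaly.lean`;
Cheskidov 2023, Thm. 2.1, second subfamily with energy level `e = 0`: anomalous dissipation of the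
vanishing-viscosity limit *without* dissipation anomaly) is a statement about `2½`-dimensional
fields `u^m = (v^m, θ^m)`, `u = (ṽ, ρ̃)` on `T³` (source, §4, p. 12). Its printed proof splits into

* a **planar core** (§3, (3.2)–(3.13), from the Alberti–Crippa–Mazzucato quasi-self-similar
  mixing family, Thm. 3.1 = `Literature.Analysis.FluidPDE.alberti_crippa_mazzucato_quasi_self_similar`,
  glued in time as in Bruè–De Lellis 2023, §5; and §4, (4.2)–(4.3) with the "low" viscosities
  (4.19) `ν_m^l = m⁻¹λ_m⁻²`, `λ_m = 5^m`, for which "bound (4.3) immediately implies that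
  `‖θ^m(2)‖_{L²} → ‖ρ^m(2)‖_{L²} = 1` as `m → ∞`, and hence there is no dissipation anomaly on the
  whole interval `[0,2]`" (p. 13)), and
* the **`2½`-dimensional assembly** (Lemma 3.2, §4 p. 12: `u^m := (v^m, θ^m)` solves (NSE) with
  force `f^m = (g^m, 0)`, `u := (v, ρ)` extended by zero after `t = 1` "is a weak solution of the
  Euler equation with force `f = (g, 0)` … on the extended time interval `[0,2]`").

This file vendors the planar core as ONE named fact, `cheskidov_noAnomaly_family`, exactly as the
accepted sibling `Literature.Analysis.FluidPDE.cheskidov_total_dissipation_family`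
(`CheskidovTotalDissipation.lean`) does for the "high" viscosities `ν_m^h` of (4.4)/(4.13) behind
Thm. 1.3; the `2½`-dimensional assembly is *proved* from it
(`Literature/Barriers/AnomalousDissipation/AnomalousDissipationWithoutDissipationAnomalyProofs.lean`).
The two facts share the objects of §3 (drifts `v^m`, datum `ρ_in`, profile `(ṽ, ρ̃)`, forces
`g^m → g`) but not the viscosities, hence not the scalars `θ^m`; being existential statements they
cannot share witnesses, so the common clauses are repeated here (same rendering).

## The clauses and their provenance (all page/equation numbers: Cheskidov, arXiv:2311.04182v1)

* viscosities `ν_m > 0`, `ν_m → 0` — (4.19) `ν_m^l := m⁻¹λ_m⁻²`;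
* drifts `v^m ∈ C^∞(ℝ × T²; ℝ²)`, divergence free, `= ṽ^m` ((3.4)) on `[0,1)` and `0` on `[1,2]`
  (p. 12), vanishing for `t ∉ (0,1)` (by (3.4) `ṽ^m = 0` on `[t_{m+1}, 1]` and at `t = 0`, where
  the gluing function is flat; values for `t < 0` are irrelevant and taken `0`);
* the glued inviscid scalars `ρ^m ∈ C^∞([0,2] × T²)` (p. 12: `ρ̃^m` of (3.5) on `[0,1)`, frozen
  at `ρ^m(1) = ρ_m(·,1)` on `[1,2]`), classical solutions of the transport equation with drift
  `v^m` on `[0,2]` (p. 12) from the datum `ρ_in = ρ₁(0)` ((3.2)), of zero mean and unit `L²` norm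
  (Thm. 3.1 (b)), with `‖ρ^m(1)‖_{Ḣ⁻¹} ≤ C λ_m⁻¹` ((3.6));
* eventual stationarity: on `[0,T]`, `T < 1`, `v^m = ṽ` and `ρ^m = ρ̃` for `m` large ((3.4)–(3.5)
  versus (3.7)–(3.8): the sums agree as soon as `T < t_{m+1}`);
* the profile `(ṽ, ρ̃)`: a smooth solution of the transport equation on `[0,1)` ((3.9)) with
  `|ρ̃| ≤ 10`, `‖ρ̃(t)‖_{L²} = 1` (Thm. 3.1 (b)), `ṽ` bounded (Thm. 3.1 (a), `α = k = 0`, with the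
  rescaling factors of (3.7)), and the blow-up (3.10): `‖ṽ(t)‖_{L²} → 0` (from
  `lim_{t→1⁻} ‖u(t)‖_{L²} = 1 = ‖ρ̃(t)‖_{L²}`) and `ρ̃(t) ⇀ 0` weakly in `L²` as `t → 1⁻`;
* the viscous scalars `θ^m ∈ C^∞([0,2] × T²)` ((4.2)): `∂ₜθ^m + v^m·∇θ^m = ν_m Δθ^m` on `[0,2]`,
  `θ^m(0) = ρ_in`, with the energy equality `‖θ^m(t)‖² + 2ν_m∫₀ᵗ‖∇θ^m‖² = ‖θ^m(0)‖² = 1`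
  (p. 12, "by the energy equality for `θ^m`");
* **no dissipation anomaly** ((4.3) with `T = 2` and (4.19): `sup_{t ∈ [0,2]} ‖θ^m(t) - ρ^m(t)‖²
  ≲ √(ν_m^l (2 - t_m)) λ_m → 0`; p. 13, the sentence quoted above);
* the planar gradients of the drifts dissipate nothing: `ν_m ∫₀² ‖∇v^m‖²_{L²} dt → 0`
  (Lemma 3.2, (3.16));
* the forces: `g := ∂ₜṽ + (ṽ·∇)ṽ` on `[0,1)` ((3.11)), `g := 0` on `[1,2]` (p. 12, `f = (g,0) =
  (∂ₜv + (v·∇)v, 0)` with `v = 0` there), `g^m := ∂ₜv^m + (v^m·∇)v^m - ν_m Δv^m` ((3.13),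
  `Torus.nsBodyForce`), and `g^m → g` in `C([0,1]; C^α(T²))` for every `α ∈ (0,1)` (p. 10, for
  any `ν_m ≲ m^s λ_m⁻²`; Bruè–De Lellis 2023, Lemma 5.1), extended to `[0,2]` where both vanish;
  `g` is bounded (a member of `C([0,1]; C^α)`).

## Lean rendering

As in `CheskidovTotalDissipation.lean`: fields are time-first on `T² = UnitAddTorus (Fin 2)`;
smoothness on `ℝ × T²` is `Torus.IsSmoothSpaceTimeOn univ`; the (advection–)transport equations
are the accepted `Torus.IsClassicalScalarTransportOn S κ` (one-sided time derivatives within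
`S = Icc 0 2`, resp. `S = Ico 0 1` for the profile); `‖∇θ‖²_{L²} = Torus.scalarGradNormSq`,
`‖∇v‖²_{L²} = Torus.gradNormSq`; `C^α(T²)` is the accepted `eBoundedHolderNorm α`
(`‖·‖_∞ + [·]_α` for the product metric of `T²`, equivalent to the flat one); `Ḣ⁻¹` is
`Torus.eHomSobolevSeminorm (-1)` of the complexified scalar (the rendering of
`QuasiSelfSimilarMixing.lean`); "`sup_t ‖·‖_{L²} → 0`" is `⨆ t ∈ Icc 0 2, eLpNorm (·) 2 volume → 0`
in `ℝ≥0∞`; weak convergence in `L²(T²)` is tested against real `MemLp w 2` functions; the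
one-sided limit `t → 1⁻` is the filter `𝓝[<] 1`. The sequence index `m : ℕ` is the source's
`m` up to relabelling.

## What is NOT vendored

The subsequence-free convergence `u^{ν} → u` in `C_w([0,2]; L²)` as a statement about planar
objects, the intermediate viscosities and energy levels `e ∈ (0,1)` (continuous dependence on
`ν`, p. 13), the absolute continuity of the limiting energy profile (Arzelà–Ascoli, p. 13), and
the first subfamily (vendored in `cheskidov_total_dissipation_family`).

## References

* A. Cheskidov, *Dissipation anomaly and anomalous dissipation in incompressible fluid flows*,
  arXiv:2311.04182 (2023): Thm. 2.1, Thm. 3.1, (3.2)–(3.13), Lemma 3.2 with (3.16), §4 pp. 12–13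
  ((4.2), (4.3), (4.19), (4.20)).
* E. Bruè, C. De Lellis, *Anomalous dissipation for the forced 3D Navier–Stokes equations*,
  Comm. Math. Phys. 400 (2023), Thm. 4.1, §5 (5.1)–(5.4), Lemma 5.1.
* G. Alberti, G. Crippa, A. L. Mazzucato, *Exponential self-similar mixing by incompressible
  flows*, J. Amer. Math. Soc. 32 (2019).
-/

noncomputable section

open MeasureTheory Set Filter
open _root_.Topology
open scoped ENNReal NNReal

namespace Literature.Analysis.FluidPDE

section Turb

/-- **Cheskidov's no-dissipation-anomaly family** (arXiv:2311.04182, §3 (3.2)–(3.13), Lemma 3.2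
(3.16), §4 (4.2), (4.3), (4.19)–(4.20); drifts = the glued Alberti–Crippa–Mazzucato /
Bruè–De Lellis velocities). There exist: viscosities `ν_m > 0`, `ν_m → 0`; planar drifts
`v^m ∈ C^∞(ℝ × T²; ℝ²)`, divergence free, vanishing for `t ∉ (0,1)`; a smooth datum `ρ_in` with
`‖ρ_in‖²_{L²} = 1`; classical solutions `θ^m` of `∂ₜθ^m + v^m·∇θ^m = ν_m Δθ^m` on `[0,2]`,
`θ^m(0) = ρ_in`, with the energy equality `‖θ^m(t)‖² + 2ν_m ∫₀ᵗ ‖∇θ^m‖² = 1`; classical solutions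
`ρ^m` of the transport equation with drift `v^m` on `[0,2]`, `ρ^m(0) = ρ_in`, frozen on `[1,2]`
(`ρ^m(t) = ρ^m(1)`), of zero mean and unit `L²` norm, with `‖ρ^m(1)‖_{Ḣ⁻¹} ≤ C 5^{-m}`; a profile
`(ṽ, ρ̃)`, a smooth solution of the transport equation on `[0,1)` with which `(v^m, ρ^m)` agree on
every `[0,T]`, `T < 1`, for `m` large, with `‖ṽ‖ ≤ B`, `|ρ̃| ≤ 10`, `‖ρ̃(t)‖²_{L²} = 1`, and, as
`t → 1⁻`, `‖ṽ(t)‖_{L²} → 0` and `ρ̃(t) ⇀ 0` weakly in `L²`; **no dissipation anomaly**: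
`sup_{t ∈ [0,2]} ‖θ^m(t) - ρ^m(t)‖_{L²} → 0` and `ν_m ∫₀² ‖∇v^m‖² → 0`; and a planar force `g`,
`g = ∂ₜṽ + (ṽ·∇)ṽ` on `[0,1)`, `g = 0` on `[1,2]`, `‖g‖ ≤ B` on `[0,2]`, with
`sup_{t ∈ [0,2]} ‖g^m(t) - g(t)‖_{C^α} → 0` for every `0 < α < 1`, where
`g^m = ∂ₜv^m + (v^m·∇)v^m - ν_m Δv^m` (`Torus.nsBodyForce`). Clause-by-clause provenance in the
module docstring. [cite: Cheskidov2023, §3 (3.2)–(3.13), Lemma 3.2, §4 (4.2)–(4.3) and (4.19)–(4.20)] [cite: BrueDeLellisCMP2023, Thm. 4.1, Lemma 5.1] -/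
def cheskidov_noAnomaly_family : Prop :=
  ∃ (ν : ℕ → ℝ) (v : ℕ → ℝ → UnitAddTorus (Fin 2) → EuclideanSpace ℝ (Fin 2))
      (ρin : UnitAddTorus (Fin 2) → ℝ) (θ ρ : ℕ → ℝ → UnitAddTorus (Fin 2) → ℝ)
      (vt : ℝ → UnitAddTorus (Fin 2) → EuclideanSpace ℝ (Fin 2)) (ρt : ℝ → UnitAddTorus (Fin 2) → ℝ)
      (g : ℝ → UnitAddTorus (Fin 2) → EuclideanSpace ℝ (Fin 2)) (B : ℝ),
    -- viscosities (4.19)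
    (∀ m, 0 < ν m) ∧ Tendsto ν atTop (𝓝 0) ∧
    -- the drifts (3.4), p. 12
    (∀ m, FunctionSpaces.Torus.IsSmoothSpaceTimeOn univ (v m)) ∧
    (∀ m t, FunctionSpaces.Torus.IsDivFree (v m t)) ∧
    (∀ m, ∀ t ∉ Ioo (0 : ℝ) 1, v m t = 0) ∧
    -- the datum (3.2)
    FunctionSpaces.Torus.IsSmooth ρin ∧ ∫ x, ρin x ^ 2 = 1 ∧
    -- the viscous scalars (4.2) and their energy equality (p. 12)
    (∀ m, Torus.IsClassicalScalarTransportOn (Icc 0 2) (ν m) (v m) (θ m) ∧ θ m 0 = ρin) ∧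
    (∀ m, ∀ t ∈ Icc (0 : ℝ) 2,
      (∫ x, θ m t x ^ 2) + 2 * ν m * ∫ s in (0 : ℝ)..t, Torus.scalarGradNormSq (θ m s) = 1) ∧
    -- the glued inviscid scalars `ρ^m` (p. 12, (3.5)–(3.6), Thm. 3.1 (b))
    (∀ m, Torus.IsClassicalScalarTransportOn (Icc 0 2) 0 (v m) (ρ m) ∧ ρ m 0 = ρin) ∧
    (∀ m, ∀ t ∈ Icc (1 : ℝ) 2, ρ m t = ρ m 1) ∧
    (∀ m, ∀ t ∈ Icc (0 : ℝ) 2, FunctionSpaces.Torus.HasZeroMean (ρ m t) ∧ ∫ x, ρ m t x ^ 2 = 1) ∧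
    (∃ C : ℝ, ∀ m : ℕ, FunctionSpaces.Torus.eHomSobolevSeminorm (-1) (fun x => (ρ m 1 x : ℂ)) ≤
      ENNReal.ofReal (C * (5 ^ m)⁻¹)) ∧
    -- eventual stationarity and the profile `(ṽ, ρ̃)` ((3.4)–(3.5) versus (3.7)–(3.9))
    (∀ T ∈ Ico (0 : ℝ) 1, ∃ m₁ : ℕ, ∀ m ≥ m₁, ∀ t ∈ Icc (0 : ℝ) T, v m t = vt t ∧ ρ m t = ρt t) ∧
    Torus.IsClassicalScalarTransportOn (Ico 0 1) 0 vt ρt ∧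
    (∀ t ∈ Ico (0 : ℝ) 1, ∀ x, ‖vt t x‖ ≤ B ∧ |ρt t x| ≤ 10) ∧
    (∀ t ∈ Ico (0 : ℝ) 1, ∫ x, ρt t x ^ 2 = 1) ∧
    -- the blow-up (3.10): `ṽ(t) → 0` in `L²` and `ρ̃(t) ⇀ 0` weakly in `L²` as `t → 1⁻`
    Tendsto (fun t => ∫ x, ‖vt t x‖ ^ 2) (𝓝[<] 1) (𝓝 0) ∧
    (∀ w : UnitAddTorus (Fin 2) → ℝ, MemLp w 2 volume →
      Tendsto (fun t => ∫ x, ρt t x * w x) (𝓝[<] 1) (𝓝 0)) ∧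
    -- no dissipation anomaly on `[0,2]` ((4.3) with (4.19); Lemma 3.2, (3.16))
    Tendsto (fun m => ⨆ t ∈ Icc (0 : ℝ) 2, eLpNorm (θ m t - ρ m t) 2 volume) atTop (𝓝 0) ∧
    Tendsto (fun m => ν m * ∫ t in (0 : ℝ)..2, FunctionSpaces.Torus.gradNormSq (v m t)) atTop (𝓝 0) ∧
    -- the forces (3.11), (3.13) and their convergence in `C([0,2]; C^α)` (p. 10; BDL Lemma 5.1)
    (∀ t ∈ Ico (0 : ℝ) 1, ∀ x, g t x =
      FunctionSpaces.Torus.timeDerivWithin (Ico 0 1) vt t x + FunctionSpaces.Torus.convect (vt t) (vt t) x) ∧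
    (∀ t ∈ Icc (1 : ℝ) 2, g t = 0) ∧
    (∀ t ∈ Icc (0 : ℝ) 2, ∀ x, ‖g t x‖ ≤ B) ∧
    (∀ α : ℝ≥0, 0 < α → α < 1 →
      Tendsto (fun m => ⨆ t ∈ Icc (0 : ℝ) 2,
        FunctionSpaces.eBoundedHolderNorm α (Torus.nsBodyForce (ν m) (v m) t - g t)) atTop (𝓝 0))

end Turb

end Literature.Analysis.FluidPDE

end
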